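import Literature.NumberTheory.Rogawski1990.CartanAlgebra
import HarnessLib

/-!
# Transport of Cartan subgroups of `U(H)` along a `⋆`-compatible conjugation, and the class `[g⋆ g] ∈ (L[γ]^⋆)ˣ ∕ N(L[γ]ˣ)` of a stable conjugator of TORI
# (Rogawski 1990, §3.5 Prop. 3.5.2 p. 29, §3.6 p. 31: the `U(H)`-classes of Cartan subgroups inside a stable class are governed by `H¹(F, T) = Kˣ∕N(K′ˣ)`)

Topic `NumberTheory/Rogawski1990`; namespace `Literature.NumberTheory.Rogawski1990`.  THEOREMS ONLY (no definition, no instance, no notation, no named fact,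
no `sorry`); over ★ `CartanAlgebra` (`hermStar σ H y = H⁻¹ ᵗ(σy) H`, `cartanAlgebra`) and ★ `ShimuraVarieties.unitaryGroup σ H ≤ GL_n(R)`.  Cell `pub/hodgecm-mathlib`,
crux H413 = `stmt-HodgeConjecture-24833` (supports-only lane), line LH6 «StCharTS», (S-𝔇) datum road, brick (B5) «CARTAN-CLASS-INVARIANT» of the p03 lineage's
«CARTAN-FIN (N1)» road (finitely many `U(H)`-conjugacy classes of Cartan subgroups).

THE MATHEMATICS (`R` a commutative ring with endomorphism `σ`, `H ∈ GL_n(R)`, `⋆ = hermStar σ H`, `U = U(H)(R) = {u : u⋆ u = 1}`).  Let `g ∈ GL_n(R)` be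
`⋆`-COMPATIBLE on a matrix `b`: `(g b g⁻¹)⋆ = g b⋆ g⁻¹` — this is what conjugation by a STABLE CONJUGATOR OF TORI satisfies on the Cartan algebra `B₀ = Z(γ₀)`
(it maps `(B₀, ⋆)` isomorphically onto another `⋆`-stable Cartan algebra).  Then:
* §1 `mem_unitaryGroup_iff_hermStar_mul_self` (`u ∈ U ↔ u⋆ u = 1`); **`conj_mem_unitaryGroup_of_hermStar_conj`**: `u ∈ U` and `g` `⋆`-compatible on `u` ⇒ `g u g⁻¹ ∈ U`
  (so `g` carries the torus `T₀ = U ∩ B₀` INTO `U`); `isUnit_hermStar`, `hermStar_coe_units_inv`.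
* §2 the invariant `x_g := g⋆ g`: `hermStar_hermStar_mul_self` (`x_g⋆ = x_g`), **`commute_hermStar_mul_self_of_hermStar_conj`** (`⋆`-compatibility on `b` ⇒ `x_g` commutes with
  `b⋆`; with `b = γ₀⁻¹`: `x_g ∈ Z(γ₀)`, `hermStar_mul_self_mem_cartanAlgebra`), `hermStar_mul_mul_self` (`x_{g a} = a⋆ x_g a`).
* §3 **`exists_unitary_mul_of_hermStar_mul_self_eq`** — the CLASS GOVERNS THE `U`-ORBIT: if `x_{g′} = x_g · (a⋆ a)` with `a` commuting with `x_g` (e.g. `a ∈ Z(γ₀)`, a NORM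
  from the Cartan algebra), then `g′ = u · g · a` with `u ∈ U` (`u := g′ (g a)⁻¹` has `u⋆ u = 1`); field form `…_of_mem_cartanAlgebra` (commutativity of `Z(γ₀)` for `γ₀`
  regular semisimple, ★ `mul_comm_of_mem_cartanAlgebra`).  Consequently two stable conjugates `g γ₀ g⁻¹`, `g′ γ₀ g′⁻¹` (`a ∈ Z(γ₀)`) are `U`-CONJUGATE
  (`conj_eq_conj_conj_of_eq_mul_mul`), and so are their centralisers.
* §4 group bookkeeping in `U`: `centralizer_singleton_conj_eq_map` (`Z(u δ u⁻¹) = u Z(δ) u⁻¹`), **`centralizer_eq_centralizer_of_mem_adjoin`** (two elements of `U` that are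
  polynomials in each other — two regular elements of the same Cartan algebra — have the same centraliser).
These are the transport steps of [Rogawski1990, §3.5–3.6]: the Cartan subgroups in the stable class of `T₀ = Z_U(γ₀)` are the `Z_U(g γ₀ g⁻¹)` for `⋆`-compatible `g`, and
their `U`-class only depends on `[x_g] ∈ (Z(γ₀)^⋆)ˣ ∕ {a⋆ a}`; with the finiteness of that quotient (bricks (B1)(B6)) and of the stable classes ((B2)(B3)(B4)) this yields
finitely many conjugacy classes of Cartan subgroups ((B7)).  HC_CM is proved only modulo the printed citations until rung 0 closes; this file is unconditional
matrix algebra (count-neutral).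

## References
* [Rogawski1990] J. D. Rogawski, *Automorphic Representations of Unitary Groups in Three Variables*, Ann. of Math. Stud. 123 (1990), §3.1 p. 19, §3.5 Prop. 3.5.2
  p. 29, §3.6 p. 31.
* [Kottwitz1986] R. E. Kottwitz, *Stable trace formula: elliptic singular terms*, Math. Ann. 275 (1986), §7.
* [PlatonovRapinchuk1994] V. Platonov, A. Rapinchuk, *Algebraic Groups and Number Theory* (1994), §6.4 (finiteness of classes of maximal tori over local fields).
-/

set_option autoImplicit false

noncomputable section

namespace Literature.NumberTheory.Rogawski1990

open scoped MatrixGroups Matrix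
open Literature.AlgebraicGeometry.ShimuraVarieties (unitaryGroup mem_unitaryGroup_iff)

section Ring

variable {R : Type*} [CommRing R] {n : Type*} [Fintype n] [DecidableEq n] (σ : R →+* R) (H : Matrix n n R)

/-! ## §1 `U = {u⋆ u = 1}`; a `⋆`-compatible conjugation carries unitary elements to unitary elements -/

/-- `u ∈ U(H)(R) ↔ u⋆ u = 1` (for `H` invertible). [cite: Rogawski1990, §3.1 p. 19] -/
theorem mem_unitaryGroup_iff_hermStar_mul_self (hH : IsUnit H.det) (u : GL n R) :
    u ∈ unitaryGroup σ H ↔ hermStar σ H (u : Matrix n n R) * (u : Matrix n n R) = 1 := by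
  refine ⟨fun hu => hermStar_mul_self_of_mem_unitaryGroup σ H hH hu, fun h => ?_⟩
  rw [mem_unitaryGroup_iff]
  rw [hermStar_def, Matrix.mul_assoc, Matrix.mul_assoc] at h
  have h2 : H * (H⁻¹ * (((u : Matrix n n R).map σ)ᵀ * (H * (u : Matrix n n R)))) = H * 1 := by rw [h]
  rw [← Matrix.mul_assoc H, Matrix.mul_nonsing_inv H hH, Matrix.one_mul, Matrix.mul_one, ← Matrix.mul_assoc] at h2
  exact h2

/-- `(g⁻¹)⋆ = (g⋆)⁻¹`: `g⋆ (g⁻¹)⋆ = 1`. [cite: Rogawski1990, §3.5 p. 29] -/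
theorem hermStar_mul_hermStar_coe_inv (hH : IsUnit H.det) (g : GL n R) :
    hermStar σ H (g : Matrix n n R) * hermStar σ H ((g⁻¹ : GL n R) : Matrix n n R) = 1 := by
  rw [← hermStar_mul σ H hH, ← Units.val_mul, inv_mul_cancel, Units.val_one, hermStar_one σ H hH]

/-- `(g⁻¹)⋆ g⋆ = 1`. [cite: Rogawski1990, §3.5 p. 29] -/
theorem hermStar_coe_inv_mul_hermStar (hH : IsUnit H.det) (g : GL n R) :
    hermStar σ H ((g⁻¹ : GL n R) : Matrix n n R) * hermStar σ H (g : Matrix n n R) = 1 := by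
  rw [← hermStar_mul σ H hH, ← Units.val_mul, mul_inv_cancel, Units.val_one, hermStar_one σ H hH]

/-- `g⋆` is invertible for `g ∈ GL_n(R)`. [cite: Rogawski1990, §3.5 p. 29] -/
theorem isUnit_hermStar (hH : IsUnit H.det) (g : GL n R) : IsUnit (hermStar σ H (g : Matrix n n R)) :=
  (Matrix.isUnit_iff_isUnit_det _).2 (Matrix.isUnit_det_of_right_inverse (hermStar_mul_hermStar_coe_inv σ H hH g))

/-- `x_g := g⋆ g` is invertible. [cite: Rogawski1990, §3.5 p. 29] -/
theorem isUnit_hermStar_mul_self (hH : IsUnit H.det) (g : GL n R) : IsUnit (hermStar σ H (g : Matrix n n R) * (g : Matrix n n R)) :=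
  (isUnit_hermStar σ H hH g).mul (Units.isUnit g)

/-- **A `⋆`-compatible conjugation preserves unitarity**: if `u ∈ U(H)(R)` and `(g u g⁻¹)⋆ = g u⋆ g⁻¹`, then `g u g⁻¹ ∈ U(H)(R)`.
[cite: Rogawski1990, §3.5 p. 29; §3.6 p. 31] -/
theorem conj_mem_unitaryGroup_of_hermStar_conj (hH : IsUnit H.det) {g u : GL n R} (hu : u ∈ unitaryGroup σ H)
    (hAd : hermStar σ H ((g : Matrix n n R) * (u : Matrix n n R) * ((g⁻¹ : GL n R) : Matrix n n R)) =
      (g : Matrix n n R) * hermStar σ H (u : Matrix n n R) * ((g⁻¹ : GL n R) : Matrix n n R)) :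
    g * u * g⁻¹ ∈ unitaryGroup σ H := by
  rw [mem_unitaryGroup_iff_hermStar_mul_self σ H hH, Units.val_mul, Units.val_mul, hAd]
  have hu' := hermStar_mul_self_of_mem_unitaryGroup σ H hH hu
  calc (g : Matrix n n R) * hermStar σ H (u : Matrix n n R) * ((g⁻¹ : GL n R) : Matrix n n R) * ((g : Matrix n n R) * (u : Matrix n n R) * ((g⁻¹ : GL n R) : Matrix n n R))
      = (g : Matrix n n R) * hermStar σ H (u : Matrix n n R) * (((g⁻¹ : GL n R) : Matrix n n R) * (g : Matrix n n R)) * (u : Matrix n n R) * ((g⁻¹ : GL n R) : Matrix n n R) := by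
        simp only [Matrix.mul_assoc]
    _ = 1 := by
        rw [← Units.val_mul, inv_mul_cancel, Units.val_one, Matrix.mul_one, Matrix.mul_assoc (g : Matrix n n R), hu', Matrix.mul_one, ← Units.val_mul,
          mul_inv_cancel, Units.val_one]

/-! ## §2 The invariant `x_g = g⋆ g` -/

/-- `x_g⋆ = x_g` (`σ` involutive, `H` hermitian). [cite: Rogawski1990, §3.5 Prop. 3.5.2 p. 29] -/
theorem hermStar_hermStar_mul_self (hH : IsUnit H.det) (hσ : ∀ r : R, σ (σ r) = r) (hHh : (H.map σ)ᵀ = H) (g : Matrix n n R) :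
    hermStar σ H (hermStar σ H g * g) = hermStar σ H g * g := by
  rw [hermStar_mul σ H hH, hermStar_hermStar σ H hH hσ hHh]

/-- **`⋆`-compatibility on `b` makes `x_g = g⋆ g` commute with `b⋆`**: from `(g b g⁻¹)⋆ = g b⋆ g⁻¹`, i.e. `(g⁻¹)⋆ b⋆ g⋆ = g b⋆ g⁻¹`, multiply by `g⋆` on the left and `g` on
the right. [cite: Rogawski1990, §3.5 Prop. 3.5.2 p. 29] -/
theorem commute_hermStar_mul_self_of_hermStar_conj (hH : IsUnit H.det) {g : GL n R} {b : Matrix n n R}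
    (hAd : hermStar σ H ((g : Matrix n n R) * b * ((g⁻¹ : GL n R) : Matrix n n R)) = (g : Matrix n n R) * hermStar σ H b * ((g⁻¹ : GL n R) : Matrix n n R)) :
    Commute (hermStar σ H b) (hermStar σ H (g : Matrix n n R) * (g : Matrix n n R)) := by
  rw [hermStar_mul σ H hH, hermStar_mul σ H hH] at hAd
  -- hAd : (g⁻¹)⋆ * (b⋆ * g⋆) = g * b⋆ * g⁻¹
  have h := congrArg (fun X => hermStar σ H (g : Matrix n n R) * X * (g : Matrix n n R)) hAd
  have lhs : hermStar σ H (g : Matrix n n R) * (hermStar σ H ((g⁻¹ : GL n R) : Matrix n n R) * (hermStar σ H b * hermStar σ H (g : Matrix n n R))) * (g : Matrix n n R) =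
      hermStar σ H b * (hermStar σ H (g : Matrix n n R) * (g : Matrix n n R)) := by
    rw [← Matrix.mul_assoc (hermStar σ H (g : Matrix n n R)), hermStar_mul_hermStar_coe_inv σ H hH g, Matrix.one_mul, Matrix.mul_assoc]
  have rhs : hermStar σ H (g : Matrix n n R) * ((g : Matrix n n R) * hermStar σ H b * ((g⁻¹ : GL n R) : Matrix n n R)) * (g : Matrix n n R) =
      hermStar σ H (g : Matrix n n R) * (g : Matrix n n R) * hermStar σ H b := by
    simp only [Matrix.mul_assoc]
    rw [← Units.val_mul, inv_mul_cancel, Units.val_one, Matrix.mul_one]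
  rw [lhs, rhs] at h
  exact h

/-- Under `⋆`-compatibility of `g` on `γ₀⁻¹` (`γ₀ ∈ U(H)(R)`), **`x_g = g⋆ g ∈ Z(γ₀)`** (it commutes with `(γ₀⁻¹)⋆ = γ₀`). [cite: Rogawski1990, §3.5 Prop. 3.5.2 p. 29] -/
theorem hermStar_mul_self_mem_cartanAlgebra (hH : IsUnit H.det) (hσ : ∀ r : R, σ (σ r) = r) (hHh : (H.map σ)ᵀ = H) {g γ₀ : GL n R}
    (hγ₀ : γ₀ ∈ unitaryGroup σ H)
    (hAd : hermStar σ H ((g : Matrix n n R) * ((γ₀⁻¹ : GL n R) : Matrix n n R) * ((g⁻¹ : GL n R) : Matrix n n R)) =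
      (g : Matrix n n R) * hermStar σ H ((γ₀⁻¹ : GL n R) : Matrix n n R) * ((g⁻¹ : GL n R) : Matrix n n R)) :
    hermStar σ H (g : Matrix n n R) * (g : Matrix n n R) ∈ cartanAlgebra (γ₀ : Matrix n n R) := by
  have hc := commute_hermStar_mul_self_of_hermStar_conj σ H hH hAd
  -- `(γ₀⁻¹)⋆ = γ₀⋆⋆ = γ₀`
  rw [← hermStar_coe_eq_inv_of_mem_unitaryGroup σ H hH hγ₀, hermStar_hermStar σ H hH hσ hHh] at hc
  exact mem_cartanAlgebra_iff.2 hc.symm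

/-- `x_{g a} = a⋆ x_g a`. [cite: Rogawski1990, §3.5 Prop. 3.5.2 p. 29] -/
theorem hermStar_mul_mul_self (hH : IsUnit H.det) (g a : Matrix n n R) :
    hermStar σ H (g * a) * (g * a) = hermStar σ H a * (hermStar σ H g * g) * a := by
  rw [hermStar_mul σ H hH]
  simp only [Matrix.mul_assoc]

/-! ## §3 The class `[x_g]` modulo norms `a⋆ a` governs the `U`-orbit -/

/-- If `x_{g′} = x_y` (`g′⋆ g′ = y⋆ y`) then `g′ y⁻¹ ∈ U(H)(R)`. [cite: Rogawski1990, §3.5 Prop. 3.5.2 p. 29] -/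
theorem mul_inv_mem_unitaryGroup_of_hermStar_mul_self_eq (hH : IsUnit H.det) {g' y : GL n R}
    (h : hermStar σ H (g' : Matrix n n R) * (g' : Matrix n n R) = hermStar σ H (y : Matrix n n R) * (y : Matrix n n R)) :
    g' * y⁻¹ ∈ unitaryGroup σ H := by
  rw [mem_unitaryGroup_iff_hermStar_mul_self σ H hH, Units.val_mul, hermStar_mul σ H hH]
  calc hermStar σ H ((y⁻¹ : GL n R) : Matrix n n R) * hermStar σ H (g' : Matrix n n R) * ((g' : Matrix n n R) * ((y⁻¹ : GL n R) : Matrix n n R))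
      = hermStar σ H ((y⁻¹ : GL n R) : Matrix n n R) * (hermStar σ H (g' : Matrix n n R) * (g' : Matrix n n R)) * ((y⁻¹ : GL n R) : Matrix n n R) := by
        simp only [Matrix.mul_assoc]
    _ = 1 := by
        rw [h, ← Matrix.mul_assoc, Matrix.mul_assoc, ← Units.val_mul, mul_inv_cancel, Units.val_one, Matrix.mul_one, hermStar_coe_inv_mul_hermStar σ H hH]

/-- **The class of `x_g` modulo norms governs the `U(H)`-orbit**: if `x_{g′} = x_g · (a⋆ a)` for an invertible `a` COMMUTING with `x_g`, then `g′ = u · g · a` with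
`u ∈ U(H)(R)`. [cite: Rogawski1990, §3.5 Prop. 3.5.2 p. 29; §3.6 p. 31] -/
theorem exists_unitary_mul_of_hermStar_mul_self_eq (hH : IsUnit H.det) {g g' a : GL n R}
    (hcomm : Commute (hermStar σ H (g : Matrix n n R) * (g : Matrix n n R)) (hermStar σ H (a : Matrix n n R)))
    (h : hermStar σ H (g' : Matrix n n R) * (g' : Matrix n n R) =
      hermStar σ H (g : Matrix n n R) * (g : Matrix n n R) * (hermStar σ H (a : Matrix n n R) * (a : Matrix n n R))) :
    ∃ u : GL n R, u ∈ unitaryGroup σ H ∧ g' = u * g * a := by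
  -- `x_{g a} = a⋆ x_g a = x_g a⋆ a = x_{g′}`
  have hga : hermStar σ H ((g * a : GL n R) : Matrix n n R) * ((g * a : GL n R) : Matrix n n R) =
      hermStar σ H (g : Matrix n n R) * (g : Matrix n n R) * (hermStar σ H (a : Matrix n n R) * (a : Matrix n n R)) := by
    rw [Units.val_mul, hermStar_mul_mul_self σ H hH, ← hcomm.eq, Matrix.mul_assoc]
  refine ⟨g' * (g * a)⁻¹, mul_inv_mem_unitaryGroup_of_hermStar_mul_self_eq σ H hH (by rw [h, hga]), by group⟩

end Ring

/-! ## §3 (field) The norm form of the class criterion and `U`-conjugacy of the transported tori -/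

section Field

variable {K : Type*} [Field K] {n : Type*} [Fintype n] [DecidableEq n] (σ : K →+* K) (H : Matrix n n K)

/-- **Field form**: `γ₀` regular semisimple unitary, `g` `⋆`-compatible on `γ₀⁻¹` (so `x_g ∈ Z(γ₀)`), `a ∈ Z(γ₀)ˣ`, `x_{g′} = x_g · a⋆ a` ⇒ `g′ = u g a`, `u ∈ U`.
[cite: Rogawski1990, §3.5 Prop. 3.5.2 p. 29; §3.6 p. 31] -/
theorem exists_unitary_mul_of_hermStar_mul_self_eq_of_mem_cartanAlgebra (hH : IsUnit H.det) (hσ : ∀ r : K, σ (σ r) = r) (hHh : (H.map σ)ᵀ = H)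
    {γ₀ g g' a : GL n K} (hγ₀ : γ₀ ∈ unitaryGroup σ H) (hsep : (γ₀ : Matrix n n K).charpoly.Separable)
    (hAd : hermStar σ H ((g : Matrix n n K) * ((γ₀⁻¹ : GL n K) : Matrix n n K) * ((g⁻¹ : GL n K) : Matrix n n K)) =
      (g : Matrix n n K) * hermStar σ H ((γ₀⁻¹ : GL n K) : Matrix n n K) * ((g⁻¹ : GL n K) : Matrix n n K))
    (ha : (a : Matrix n n K) ∈ cartanAlgebra (γ₀ : Matrix n n K))
    (h : hermStar σ H (g' : Matrix n n K) * (g' : Matrix n n K) =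
      hermStar σ H (g : Matrix n n K) * (g : Matrix n n K) * (hermStar σ H (a : Matrix n n K) * (a : Matrix n n K))) :
    ∃ u : GL n K, u ∈ unitaryGroup σ H ∧ g' = u * g * a := by
  have hx := hermStar_mul_self_mem_cartanAlgebra σ H hH hσ hHh hγ₀ hAd
  have hsa : hermStar σ H (a : Matrix n n K) ∈ cartanAlgebra (γ₀ : Matrix n n K) := hermStar_mem_cartanAlgebra σ H hH hγ₀ ha
  have hc : Commute (hermStar σ H (g : Matrix n n K) * (g : Matrix n n K)) (hermStar σ H (a : Matrix n n K)) :=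
    mul_comm_of_mem_cartanAlgebra hsep hx hsa
  exact exists_unitary_mul_of_hermStar_mul_self_eq σ H hH hc h

/-- `g′ = u g a` with `a` commuting with `γ₀` ⇒ `g′ γ₀ g′⁻¹ = u (g γ₀ g⁻¹) u⁻¹`. [cite: Rogawski1990, §3.6 p. 31] -/
theorem conj_eq_conj_conj_of_eq_mul_mul {γ₀ g g' a u : GL n K} (ha : Commute a γ₀) (hg' : g' = u * g * a) :
    g' * γ₀ * g'⁻¹ = u * (g * γ₀ * g⁻¹) * u⁻¹ := by
  rw [hg']
  have : u * g * a * γ₀ * (u * g * a)⁻¹ = u * g * (a * γ₀ * a⁻¹) * g⁻¹ * u⁻¹ := by group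
  rw [this, ha.eq, mul_inv_cancel_right]
  group

end Field

/-! ## §4 Group bookkeeping inside `U(H)(R)`: conjugate centralisers, equal centralisers of mutual polynomials -/

section Group

variable {G : Type*} [Group G]

/-- `Z(u δ u⁻¹) = u Z(δ) u⁻¹` (as the image under `MulAut.conj u`). [cite: Rogawski1990, §3.6 p. 31] -/
theorem centralizer_singleton_conj_eq_map (u δ : G) :
    Subgroup.centralizer ({u * δ * u⁻¹} : Set G) = (Subgroup.centralizer ({δ} : Set G)).map (MulAut.conj u).toMonoidHom := by
  ext x
  rw [Subgroup.mem_centralizer_singleton_iff, Subgroup.mem_map_equiv, Subgroup.mem_centralizer_singleton_iff, MulAut.conj_symm_apply]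
  constructor
  · intro h
    calc u⁻¹ * x * u * δ = u⁻¹ * (x * (u * δ * u⁻¹)) * u := by group
      _ = u⁻¹ * (u * δ * u⁻¹ * x) * u := by rw [h]
      _ = δ * (u⁻¹ * x * u) := by group
  · intro h
    calc x * (u * δ * u⁻¹) = u * ((u⁻¹ * x * u) * δ) * u⁻¹ := by group
      _ = u * (δ * (u⁻¹ * x * u)) * u⁻¹ := by rw [h]
      _ = u * δ * u⁻¹ * x := by group

end Group

section Centralizer

variable {R : Type*} [CommRing R] {n : Type*} [Fintype n] [DecidableEq n] (σ : R →+* R) (H : Matrix n n R)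

/-- **Two unitary elements that are polynomials in each other have the same centraliser in `U(H)(R)`** (two regular elements of one Cartan algebra generate the
same Cartan subgroup). [cite: Rogawski1990, §3.5 p. 29; §3.6 p. 31] -/
theorem centralizer_eq_centralizer_of_mem_adjoin {γ δ : ↥(unitaryGroup σ H)}
    (hδ : ((δ : GL n R) : Matrix n n R) ∈ Algebra.adjoin R ({((γ : GL n R) : Matrix n n R)} : Set (Matrix n n R)))
    (hγ : ((γ : GL n R) : Matrix n n R) ∈ Algebra.adjoin R ({((δ : GL n R) : Matrix n n R)} : Set (Matrix n n R))) :
    Subgroup.centralizer ({γ} : Set ↥(unitaryGroup σ H)) = Subgroup.centralizer ({δ} : Set ↥(unitaryGroup σ H)) := by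
  -- commuting with an element is commuting with every polynomial in it
  have key : ∀ {α β : ↥(unitaryGroup σ H)}, ((β : GL n R) : Matrix n n R) ∈ Algebra.adjoin R ({((α : GL n R) : Matrix n n R)} : Set (Matrix n n R)) →
      ∀ x : ↥(unitaryGroup σ H), x * α = α * x → x * β = β * x := by
    intro α β hβ x hx
    have hxM : ((x : GL n R) : Matrix n n R) * ((α : GL n R) : Matrix n n R) = ((α : GL n R) : Matrix n n R) * ((x : GL n R) : Matrix n n R) := by
      rw [← Units.val_mul, ← Units.val_mul, ← Subgroup.coe_mul, ← Subgroup.coe_mul, hx]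
    have hle : Algebra.adjoin R ({((α : GL n R) : Matrix n n R)} : Set (Matrix n n R)) ≤ Subalgebra.centralizer R {((x : GL n R) : Matrix n n R)} :=
      Algebra.adjoin_le (Set.singleton_subset_iff.2 ((Subalgebra.mem_centralizer_iff R).2 fun y hy => by
        rw [Set.mem_singleton_iff] at hy; rw [hy]; exact hxM))
    have hβM : ((x : GL n R) : Matrix n n R) * ((β : GL n R) : Matrix n n R) = ((β : GL n R) : Matrix n n R) * ((x : GL n R) : Matrix n n R) :=
      ((Subalgebra.mem_centralizer_iff R).1 (hle hβ)) _ (Set.mem_singleton _)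
    apply Subtype.ext; apply Units.ext
    rw [Subgroup.coe_mul, Subgroup.coe_mul, Units.val_mul, Units.val_mul]
    exact hβM
  ext x
  rw [Subgroup.mem_centralizer_singleton_iff, Subgroup.mem_centralizer_singleton_iff]
  exact ⟨key hδ x, key hγ x⟩

end Centralizer

end Literature.NumberTheory.Rogawski1990

end
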